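import Summits.Ventures.HSemireg.WedgeHankelRecurrenceGaussChebyshevTUGcd

/-!
# Venture HSemireg — **MIXED COPRIMALITY SETTLED: `IsCoprime T_m U_{n−1} ⟺ n ∕ gcd(m,n) odd ⟺ v₂(n) ≤ v₂(m)`** (`m ≥ 1`; every domain with `2 ≠ 0`, the `⇐` half over ANY commutative ring),
# the resultant form **`Res_{(m,n)}(T_m, U_n) = 0 ⟺ (n+1) ∕ gcd(m, n+1)` even** over `ℤ`, and the node form «the `m`-point Gauss–Chebyshev rule and the `(n−1)`-point Fejér ∕ second-kind rule
# share a node iff `v₂(n) > v₂(m)`» (with the shared nodes = the zeros of `T_{gcd(m,n)}`)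

HONEST FRAMING. Part of the Lean index of the computation cell `pub-hsemireg` (seat p10 gen 48, Sunday typer «UNIFORM-IN-n»).  Polynomial ∕ ideal algebra, `ℕ`-parity and `padicValNat` bookkeeping,
one real cosine; no variety, no cohomology theory, no sheaf, no Ext group and no semiregularity map is constructed here; nothing here says that HC / HC_CM / HC_AV holds; no Literature fact (unproved
`Prop`) is declared or used.  Custodian versions as in `WedgeHankelSiegelIdeal` (1/3).
SOURCES (cited).  M. O. Rayes, V. Trevisan, P. S. Wang, *Factorization properties of Chebyshev polynomials*, Comput. Math. Appl. 50 (2005) 1231–1240, §4; K. Dilcher, K. B. Stolarsky, *Resultants and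
discriminants of Chebyshev and related polynomials*, Trans. Amer. Math. Soc. 357 (2005) 965–981, §3 (vanishing loci); T. J. Rivlin, *Chebyshev Polynomials* (1990), §1.2.
PROOF TYPED HERE.  N462 `chebyshevTU_span_pair_eq_top ∕ _eq_span_gcd`; N459 `span_pair_eq_top_iff_isCoprime`; Mathlib `Ideal.span_singleton_eq_top`, `Ideal.mem_span_singleton`, `natDegree_T`,
`Polynomial.natDegree_eq_zero_of_isUnit`, `resultant_map_map`, `resultant_eq_zero_iff`, `natDegree_U_natCast`, `T_real_cos`, `padicValNat.mul`, `Nat.coprime_div_gcd_div_gcd`.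
DEDUP DISCLOSURE (`rg -n 'chebyshevTU_isCoprime|chebyshevTU_not_isCoprime|even_div_gcd_iff_padicValNat_lt|chebyshevTU_resultant_eq_zero_iff|chebyshevTU_common_real_zero_iff' Summits Literature HarnessLib`,
2026-09-04): N432 `chebyshevTU_resultant_same_eq_zero_iff` ∕ `chebyshevTU_common_zero_same_iff` and N440 `…gap_two…` (special index pairs), N443 `chebyshev_isCoprime_T_U`, N446
`chebyshev_isCoprime_T_U_pred` (`n = m`); 0 hits for the 7 names below.

WHAT IS IN THE TREE.  N432, N440, N443, N446, N459, N462.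
THIS FILE (namespace `Summit.Ventures.HSemireg.Wedge.HankelOuter` continued; CHAINED on N462; 0 definitions):
* §1228 **`chebyshevTU_isCoprime_of_not_even`** (any commutative ring), **`chebyshevTU_not_isCoprime_of_even`**, **`chebyshevTU_isCoprime_iff`** (domains with `2 ≠ 0`, `m ≥ 1`),
  `even_div_gcd_iff_padicValNat_lt`, **`chebyshevTU_isCoprime_iff_padicValNat_le`**, **`chebyshevTU_resultant_eq_zero_iff`** (`ℤ`), **`chebyshevTU_common_real_zero_iff`**.
CAVEATS.  `m ≥ 1` where stated (`(T_0, U_{−1}) = (1, 0)` is the unit ideal although `0 ∕ 0` is even); `ℕ`-division conventions as in N458.  Nothing Ext-side.  New names only.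
-/

open Module Polynomial Real
open scoped Matrix Polynomial

namespace Summit.Ventures.HSemireg.Wedge.HankelOuter

/-! ## §1228. `IsCoprime T_m U_{n−1}` settled -/

/-- **`T_m`, `U_{n−1}` are coprime in `R[X]` for EVERY commutative ring `R` when `n ∕ gcd(m,n)` is odd.** [Rayes–Trevisan–Wang 2005 §4; this file, §1228] -/
theorem chebyshevTU_isCoprime_of_not_even {R : Type*} [CommRing R] {m n : ℕ} (h : ¬ Even (n / Nat.gcd m n)) :
    IsCoprime (Polynomial.Chebyshev.T R (m : ℤ)) (Polynomial.Chebyshev.U R ((n : ℤ) - 1)) :=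
  (span_pair_eq_top_iff_isCoprime _ _).1 (chebyshevTU_span_pair_eq_top h)

/-- **`m ≥ 1` and `n ∕ gcd(m,n)` even ⇒ `T_m`, `U_{n−1}` are NOT coprime** over a domain with `2 ≠ 0` (`(T_m, U_{n−1}) = (T_{gcd})`, `deg T_{gcd} = gcd ≥ 1`). [this file, §1228] -/
theorem chebyshevTU_not_isCoprime_of_even {R : Type*} [CommRing R] [IsDomain R] [NeZero (2 : R)] {m n : ℕ} (hm : 0 < m) (h : Even (n / Nat.gcd m n)) :
    ¬ IsCoprime (Polynomial.Chebyshev.T R (m : ℤ)) (Polynomial.Chebyshev.U R ((n : ℤ) - 1)) := by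
  intro hc
  have htop := (span_pair_eq_top_iff_isCoprime _ _).2 hc
  rw [chebyshevTU_span_pair_eq_span_gcd h, Ideal.span_singleton_eq_top] at htop
  have hdeg := Polynomial.natDegree_eq_zero_of_isUnit htop
  rw [Polynomial.Chebyshev.natDegree_T, Int.natAbs_natCast] at hdeg
  exact (Nat.gcd_pos_of_pos_left n hm).ne' hdeg

/-- **`IsCoprime T_m U_{n−1} ⟺ n ∕ gcd(m,n)` odd** (`m ≥ 1`; every domain with `2 ≠ 0`). [Rayes–Trevisan–Wang 2005 §4; this file, §1228] -/
theorem chebyshevTU_isCoprime_iff {R : Type*} [CommRing R] [IsDomain R] [NeZero (2 : R)] {m : ℕ} (hm : 0 < m) (n : ℕ) :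
    IsCoprime (Polynomial.Chebyshev.T R (m : ℤ)) (Polynomial.Chebyshev.U R ((n : ℤ) - 1)) ↔ Odd (n / Nat.gcd m n) := by
  rw [← Nat.not_even_iff_odd]
  exact ⟨fun hc h => chebyshevTU_not_isCoprime_of_even hm h hc, chebyshevTU_isCoprime_of_not_even⟩

/-- **2-adic reformulation: for `m, n ≠ 0`, `n ∕ gcd(m,n)` is even iff `v₂(m) < v₂(n)`.** [bookkeeping; this file, §1228] -/
theorem even_div_gcd_iff_padicValNat_lt {m n : ℕ} (hm : m ≠ 0) (hn : n ≠ 0) :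
    Even (n / Nat.gcd m n) ↔ padicValNat 2 m < padicValNat 2 n := by
  have hg0 : Nat.gcd m n ≠ 0 := Nat.gcd_ne_zero_left hm
  have ha0 : m / Nat.gcd m n ≠ 0 := (Nat.div_pos (Nat.gcd_le_left n (Nat.pos_of_ne_zero hm)) (Nat.pos_of_ne_zero hg0)).ne'
  have hb0 : n / Nat.gcd m n ≠ 0 := (Nat.div_pos (Nat.gcd_le_right m (Nat.pos_of_ne_zero hn)) (Nat.pos_of_ne_zero hg0)).ne'
  have hcop : Nat.Coprime (m / Nat.gcd m n) (n / Nat.gcd m n) := Nat.coprime_div_gcd_div_gcd (Nat.pos_of_ne_zero hg0)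
  have hvm : padicValNat 2 m = padicValNat 2 (Nat.gcd m n) + padicValNat 2 (m / Nat.gcd m n) := by
    conv_lhs => rw [← Nat.mul_div_cancel' (Nat.gcd_dvd_left m n)]
    exact padicValNat.mul hg0 ha0
  have hvn : padicValNat 2 n = padicValNat 2 (Nat.gcd m n) + padicValNat 2 (n / Nat.gcd m n) := by
    conv_lhs => rw [← Nat.mul_div_cancel' (Nat.gcd_dvd_right m n)]
    exact padicValNat.mul hg0 hb0
  rw [hvm, hvn, Nat.add_lt_add_iff_left]
  constructor
  · intro hb
    have h1 : 1 ≤ padicValNat 2 (n / Nat.gcd m n) := one_le_padicValNat_of_dvd hb0 (even_iff_two_dvd.1 hb)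
    have ha : padicValNat 2 (m / Nat.gcd m n) = 0 := by
      refine padicValNat.eq_zero_of_not_dvd fun h2 => ?_
      have h := Nat.dvd_gcd h2 (even_iff_two_dvd.1 hb)
      rw [Nat.Coprime.gcd_eq_one hcop] at h
      exact absurd h (by norm_num)
    omega
  · intro hlt
    exact even_iff_two_dvd.2 (dvd_of_one_le_padicValNat (by omega))

/-- **`IsCoprime T_m U_{n−1} ⟺ v₂(n) ≤ v₂(m)` for `m, n ≥ 1`** (every domain with `2 ≠ 0`). [Rayes–Trevisan–Wang 2005 §4 (2-adic form); this file, §1228] -/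
theorem chebyshevTU_isCoprime_iff_padicValNat_le {R : Type*} [CommRing R] [IsDomain R] [NeZero (2 : R)] {m n : ℕ} (hm : m ≠ 0) (hn : n ≠ 0) :
    IsCoprime (Polynomial.Chebyshev.T R (m : ℤ)) (Polynomial.Chebyshev.U R ((n : ℤ) - 1)) ↔ padicValNat 2 n ≤ padicValNat 2 m := by
  rw [chebyshevTU_isCoprime_iff (Nat.pos_of_ne_zero hm), ← Nat.not_even_iff_odd, even_div_gcd_iff_padicValNat_lt hm hn, not_lt]

/-- **`Res_{(m,n)}(T_m, U_n) = 0 ⟺ (n+1) ∕ gcd(m, n+1)` is even** (integer resultant of Mathlib's `T`, `U` with formal degrees `m`, `n`). [Dilcher–Stolarsky 2005 §3 (vanishing locus);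
this file, §1228] -/
theorem chebyshevTU_resultant_eq_zero_iff (m n : ℕ) :
    (Polynomial.Chebyshev.T ℤ (m : ℤ)).resultant (Polynomial.Chebyshev.U ℤ (n : ℤ)) m n = 0 ↔ Even ((n + 1) / Nat.gcd m (n + 1)) := by
  have hmap := Polynomial.resultant_map_map (f := Polynomial.Chebyshev.T ℤ (m : ℤ)) (g := Polynomial.Chebyshev.U ℤ (n : ℤ)) (m := m) (n := n) (Int.castRingHom ℝ)
  rw [Polynomial.Chebyshev.map_T, Polynomial.Chebyshev.map_U] at hmap
  have hdef : (Polynomial.Chebyshev.T ℝ (m : ℤ)).resultant (Polynomial.Chebyshev.U ℝ (n : ℤ)) m n =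
      (Polynomial.Chebyshev.T ℝ (m : ℤ)).resultant (Polynomial.Chebyshev.U ℝ (n : ℤ)) := by
    rw [Polynomial.Chebyshev.natDegree_T, Int.natAbs_natCast, Polynomial.Chebyshev.natDegree_U_natCast]
  have hidx : (n : ℤ) = (((n + 1 : ℕ)) : ℤ) - 1 := by push_cast; ring
  rw [← Int.cast_eq_zero (α := ℝ), ← eq_intCast (Int.castRingHom ℝ), ← hmap, hdef, Polynomial.resultant_eq_zero_iff, hidx]
  rcases Nat.eq_zero_or_pos m with rfl | hm
  · rw [Nat.gcd_zero_left, Nat.div_self (Nat.succ_pos n), Nat.cast_zero, Polynomial.Chebyshev.T_zero]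
    exact ⟨fun h => absurd isCoprime_one_left h.2, fun h => absurd h Nat.not_even_one⟩
  · rw [chebyshevTU_isCoprime_iff (R := ℝ) hm, Nat.not_odd_iff_even]
    exact ⟨fun h => h.2, fun h => ⟨Or.inl (Polynomial.Chebyshev.T_ne_zero ℝ _), h⟩⟩

/-- **For `m ≥ 1`: `T_m` and `U_{n−1}` have a common real zero iff `n ∕ gcd(m,n)` is even** (then every zero of `T_{gcd(m,n)}`, e.g. `cos(π ∕ (2 gcd))`, is one). [Rivlin §1.2; this file, §1228] -/
theorem chebyshevTU_common_real_zero_iff {m : ℕ} (hm : 0 < m) (n : ℕ) :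
    (∃ x : ℝ, (Polynomial.Chebyshev.T ℝ (m : ℤ)).eval x = 0 ∧ (Polynomial.Chebyshev.U ℝ ((n : ℤ) - 1)).eval x = 0) ↔ Even (n / Nat.gcd m n) := by
  constructor
  · rintro ⟨x, hxm, hxn⟩
    by_contra h
    obtain ⟨u, v, huv⟩ := chebyshevTU_isCoprime_of_not_even (R := ℝ) h
    have e := congrArg (Polynomial.eval x) huv
    rw [eval_add, eval_mul, eval_mul, hxm, hxn, mul_zero, mul_zero, add_zero, eval_one] at e
    exact zero_ne_one e
  · intro h
    have hg0 : (0 : ℝ) < Nat.gcd m n := by exact_mod_cast Nat.gcd_pos_of_pos_left n hm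
    have hzero : (Polynomial.Chebyshev.T ℝ (Nat.gcd m n : ℤ)).eval (cos (π / (2 * Nat.gcd m n))) = 0 := by
      rw [Polynomial.Chebyshev.T_real_cos, show ((Nat.gcd m n : ℤ) : ℝ) * (π / (2 * Nat.gcd m n)) = π / 2 by push_cast; field_simp, Real.cos_pi_div_two]
    have hI := chebyshevTU_span_pair_eq_span_gcd (R := ℝ) h
    have hTm : Polynomial.Chebyshev.T ℝ (Nat.gcd m n : ℤ) ∣ Polynomial.Chebyshev.T ℝ (m : ℤ) := by
      rw [← Ideal.mem_span_singleton, ← hI]; exact Ideal.subset_span (Set.mem_insert _ _)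
    have hUn : Polynomial.Chebyshev.T ℝ (Nat.gcd m n : ℤ) ∣ Polynomial.Chebyshev.U ℝ ((n : ℤ) - 1) := by
      rw [← Ideal.mem_span_singleton, ← hI]; exact Ideal.subset_span (Set.mem_insert_of_mem _ (Set.mem_singleton _))
    exact ⟨_, eval_eq_zero_of_dvd_of_eval_eq_zero hTm hzero, eval_eq_zero_of_dvd_of_eval_eq_zero hUn hzero⟩

end Summit.Ventures.HSemireg.Wedge.HankelOuter
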